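import Summits.CriticalPhenomena.SAWScalingLimit.Theorems.SAWDefectDecoherenceBoundaryClosureRGateFrameRegular
import Summits.CriticalPhenomena.SAWScalingLimit.Theorems.SAWDevelopingMapObservableToSLERestrictionCocycleHelpersReflection
import Literature.Probability.RandomPlanarGeometry.CaratheodoryHalfPlaneProofs
import HarnessLib

/-!
# `BoundaryClosureR`, line `pick-half-plane` (r15): existence of an admissible conformal datum
(crux stmt-CriticalPhenomena-14004, stub `stub_frameDatum`; registered sub-goal `frameDatum_exists`)

The repaired target `HexObservableLimitR` of the crux
`BoundaryClosureR := DefectDecoherence → MassRatio → HexObservableLimitR` quantifies over an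
ADMISSIBLE CONFORMAL DATUM `(Φ, L, L_b)` of a Dobrushin domain `(Ω; a, b) = (D.carrier; D.pt 0,
D.pt 1)`: a conformal equivalence `Φ : Ω → ℍₒ` with `‖Φ‖ → ∞` at the root `a` and `Φ → 0` at the
normaliser `b` (within `Ω`), a continuous branch `L` of `log Φ'` on `Ω`, and the finite limit
`L_b` of `L` at `b` within `Ω`.  To derive the local `L¹` law FROM the target (the necessity
direction of the r15 skeleton, stub `stub_localL1Root_necessity`) such a datum has to EXIST for
every Dobrushin domain which is flat near `b` (`Ω ∩ B(b, ρ) = {im z > im b} ∩ B(b, ρ)`).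

THEOREM (`frameDatum_exists`, the skeleton's `FrameDatumExists` UNFOLDED verbatim).  Classical,
assembled from the tree:

* a chordal uniformizing map `φ : (ℍₒ; 0, ∞) → (Ω; a, b)` exists (Riemann mapping theorem +
  Carathéodory + a Möbius map, `MarkedDomain.exists_isChordalUniformizing_holds`);
* `Φ := −1/φ⁻¹ : Ω → ℍₒ` is a conformal equivalence with `‖Φ‖ → ∞` at `a` (`φ⁻¹ → 0` there) and
  `Φ → 0` at `b` (`φ⁻¹ → ∞` there) — the landed `ObservableToSLE.FloorRatio.exists_halfPlaneMap`
  (inverse boundary behaviour `IsChordalUniformizing.tendsto_symm_nhds_zero/cocompact`);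
* `Φ'` is holomorphic and zero-free on the simply connected Jordan carrier, so it has a
  continuous logarithm `L` (`ObservableToSLE.FloorRatio.exists_log_deriv`);
* the normaliser `b = D.pt 1` is a point of the flat gate `{im = im b} ∩ B(b, ρ)` distinct from
  the root `a = D.pt 0` (`pt` is injective), so `L` has a finite limit `L_b` there within `Ω` by
  the landed frame regularity along the open gate (`gateTrace_frameRegular`, p98312: Carathéodory
  extension, Schwarz reflection, boundary Hopf lemma).

No new definitions; no model input is used.
-/

noncomputable section

open scoped Topology
open Filter Set Metric Complex
open Literature.Probability.RandomPlanarGeometry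

namespace Summit.CriticalPhenomena.SAWScalingLimit.Theorems.PickHalfPlane.Identification

/-- **Existence of an admissible conformal datum** (registered sub-goal `frameDatum_exists` of the
stub `stub_frameDatum`, r15; the skeleton's `FrameDatumExists` unfolded): for every Dobrushin
domain `D` flat near `D.pt 1` and every `ρ > 0` there are a conformal equivalence
`Φ : D.carrier → ℍₒ` with `‖Φ‖ → ∞` at `D.pt 0` and boundary value `0` at `D.pt 1`, a continuous
branch `L` of `log Φ'` on the carrier, and a finite limit `L_b` of `L` at `D.pt 1` within the
carrier.  (`Φ = −1/φ⁻¹` for a chordal uniformizing map `φ` — `exists_isChordalUniformizing_holds`,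
`exists_halfPlaneMap`; `L` from `exists_log_deriv` on the simply connected Jordan carrier; `L_b`
from `gateTrace_frameRegular` at the gate point `D.pt 1 ≠ D.pt 0`.)
[cite: PommerenkeBBCM1992, Thm. 2.6] -/
theorem frameDatum_exists :
    ∀ (D : DobrushinDomain) (ρ : ℝ), 0 < ρ →
    D.carrier ∩ Metric.ball (D.pt 1) ρ = {z : ℂ | (D.pt 1).im < z.im} ∩ Metric.ball (D.pt 1) ρ →
    ∃ (Φ : ConformalEquiv D.carrier UpperHalfPlane.upperHalfPlaneSet) (L : ℂ → ℂ) (Lb : ℂ),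
      Tendsto (fun z => ‖Φ z‖) (𝓝[D.carrier] (D.pt 0)) atTop ∧ Φ.HasBoundaryValue (D.pt 1) 0 ∧
      ContinuousOn L D.carrier ∧ (∀ z ∈ D.carrier, Complex.exp (L z) = deriv Φ z) ∧
      Tendsto L (𝓝[D.carrier] (D.pt 1)) (𝓝 Lb) := by
  intro D ρ hρ hflat
  -- a chordal uniformizing map `φ : (ℍₒ; 0, ∞) → (Ω; pt 0, pt 1)` and `Φ = -1/φ⁻¹`
  obtain ⟨φ, hφ⟩ := MarkedDomain.exists_isChordalUniformizing_holds D
  obtain ⟨Φ, -, hΦ0, hΦ1, -⟩ := ObservableToSLE.FloorRatio.exists_halfPlaneMap D φ hφ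
  -- a continuous logarithm of `Φ'` on the simply connected carrier
  obtain ⟨L, hL, hexp⟩ := ObservableToSLE.FloorRatio.exists_log_deriv D.toJordanDomain Φ
  -- the limit of `L` at the gate point `pt 1 ≠ pt 0`
  have h10 : D.pt 1 ≠ D.pt 0 := fun h => absurd (D.pt_injective h) (by decide)
  obtain ⟨Lb, hLb⟩ := gateTrace_frameRegular D ρ hflat Φ L hΦ0 hL hexp (D.pt 1) rfl
    (Metric.mem_ball_self hρ) h10
  exact ⟨Φ, L, Lb, hΦ0, hΦ1, hL, hexp, hLb⟩

end Summit.CriticalPhenomena.SAWScalingLimit.Theorems.PickHalfPlane.Identification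

end
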